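/-
Copyright (c) 2026 the pub-hodgecm-mathlib formalisation cell (harness21).  Prover seat hodgecm-mathlib-LD1-p02 (g0), organ payer of half-A
line LD1 on loan to LD2 (organ C₂at′ `ArchSignAt₂'`, dealer LD2-plan (g0) 2026-09-02T03:17:52Z), theta-side kit, 2026-09-02.
THEOREMS ONLY (no definition, no named fact, no `sorry`, no instance, no notation).  `--supports stmt-HodgeConjecture-24832 --as helper`.
-/
import Summits.HodgeConjecture.HodgeConjecture.Theorems.F0LD2ThetaTensorClasses
import Literature.NumberTheory.Automorphic.Liu2021.ThetaLiftFromLineEquivariantFunctional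
import HarnessLib

/-!
# The projected theta classes along an ABSTRACT transport `ιA` are `U(H)(𝔸)`-equivariant and CYCLIC in an irreducible `P`
# (abstract-`ιA` twins of ★ `Liu2021.ThetaLiftFromLineEquivariantFunctional` §1–§2)

Cell hodgecm-mathlib FLOOR 0, programme P6, half-A line LD (crux `hLiu418` = `stmt-HodgeConjecture-24832`), organ C₂at′ `ArchSignAt₂'` of the LD2
skeleton of record v5 (`F0/P6/LD/LD2-plan/g0/StubS1bfacts.inhouse.skeleton.v5.lean` sha16 e8da573259aec245 :325–:356).  Namespace
`Summit.HodgeConjecture.HodgeConjecture.Cruxes.HLiu418.F0LD2ThetaCyclicity`.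

The organs of the LD skeletons speak of an ABSTRACT transport `ιA : U(H)(𝔸_{L⁺}) →* U(diag dV)(𝔸_{L⁺})` (continuous, rational points to
rational points: the hypothesis `hιA` of ★ K1 `F0LD1ThetaTransportKit`), where ★ `ThetaLiftFromLineEquivariantFunctional` is typed for the one
transport `cmAdelicFrameTransport` of the UNSCALED frame.  This file re-proves its §1–§2 along `ιA`, token for token:

* §1 `starProjection_toLp_lineThetaLift_pairRep` — `pr_P [Θ̃_{ω(ιA k, 1)Ψ}(f) ∘ ιA] = R(k) (pr_P [Θ̃_Ψ(f) ∘ ιA])` (★ K1 `rightRegular_toLp_lineThetaLift`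
  + ★ `DiscreteAutomorphicRep.starProjection_rightRegular`);
* §2 `le_topologicalClosure_span_starProjection_toLp_lineThetaLift` — one non-zero projected class makes the closed span of all of them ALL of
  the irreducible `P` ([BorelJacquet1979, §4.6]; [DeitmarEchterhoff2014, Thm. 7.3.2]); `exists_inner_starProjection_toLp_lineThetaLift_ne_zero` and
  **`exists_tmul_inner_starProjection_toLp_lineThetaLift_ne_zero`** — every non-zero `v ∈ P` pairs non-trivially with the projected class of
  some PURE TENSOR `E(φ ⊗ Φ_f)` (★ `F0LD2ThetaTensorClasses.exists_tensor_of_apply_toLp_lineThetaLift_ne_zero`, [Tate1967, §3.2]);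
  `exists_tmul_inner_toLp_lineThetaLift_ne_zero_of_mem` — the same with the class IN `P` un-projected (the seam ★ `MeetsThetaLiftFromLine` currency).

HONEST SCOPE.  Representation-theoretic bookkeeping; nothing of [Liu2021] is asserted and nothing archimedean is computed.  HC_CM is proved only
modulo the printed citations until rung 0 closes; this file books nothing and discharges nothing booked.

## References
* [BorelJacquet1979] A. Borel, H. Jacquet, PSPM 33.1 (1979), §4.6 (irreducible constituents of `L²`).
* [DeitmarEchterhoff2014] A. Deitmar, S. Echterhoff, *Principles of Harmonic Analysis*, 2nd ed., Thm. 7.3.2.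
* [Tate1967] J. Tate, *Fourier analysis in number fields*, §3.2.
* [Liu2021] Y. Liu, arXiv:2102.11518, proof of Prop. 4.13 Case 1 (l. 2137–2141, p. 48).
-/

set_option autoImplicit false
set_option linter.dupNamespace false

noncomputable section

open NumberField MeasureTheory IsDedekindDomain
open scoped Matrix ComplexOrder ENNReal SchwartzMap TensorProduct InnerProductSpace Classical

namespace Summit.HodgeConjecture.HodgeConjecture.Cruxes.HLiu418.F0LD2ThetaCyclicity

open _root_.MeasureTheory
open Literature.NumberTheory.Automorphic Literature.NumberTheory.Automorphic.UnitaryGroup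
open Literature.NumberTheory.Automorphic.UnitaryGroup.CotangentForms
open Literature.NumberTheory.Automorphic.IdeleClassGroup
open Literature.NumberTheory.Automorphic.Liu2021
open Literature.NumberTheory.Automorphic.Liu2021.Def411WeilCarriers
open Literature.NumberTheory.Automorphic.Liu2021.Def411WeilCarriersDoubling
open Literature.NumberTheory.GelbartRogawski1991 Literature.NumberTheory.GelbartRogawski1991.UnitaryDualPair
open Literature.NumberTheory.Weil1964
open Literature.RepresentationTheory Literature.RepresentationTheory.Liu2021
open Summit.HodgeConjecture.HodgeConjecture.Cruxes.HLiu418.F0LD1ThetaTransportKit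
open Summit.HodgeConjecture.HodgeConjecture.Cruxes.HLiu418.F0LD2ThetaTensorClasses

variable (L : Type) [Field L] [NumberField L] [IsCMField L] (N : ℕ) (H : Matrix (Fin N) (Fin N) L)
  {n' : ℕ} (e₁ : Fin N × Fin 1 ≃ Fin n') (dV : Fin N → L) (hdV : ∀ i, IsCMField.complexConj L (dV i) = dV i)
  (hdV0 : ∀ i, dV i ≠ 0)
  (ιA : (adelicGroupData (↥(maximalRealSubfield L)) L (IsCMField.complexConj L) N H).Adelic →*
    ↥(UnitaryGroup.adelic (↥(maximalRealSubfield L)) L (IsCMField.complexConj L) N (Matrix.diagonal dV)))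
  (hιA : Continuous ιA ∧ ∀ ⦃γ : (adelicGroupData (↥(maximalRealSubfield L)) L (IsCMField.complexConj L) N H).Adelic⦄,
    γ ∈ (UnitaryGroup.toAdelic (↥(maximalRealSubfield L)) L (IsCMField.complexConj L) N H).range →
      ιA γ ∈ (UnitaryGroup.toAdelic (↥(maximalRealSubfield L)) L (IsCMField.complexConj L) N (Matrix.diagonal dV)).range)
  (μ : Literature.NumberTheory.Automorphic.IdeleClassGroup L →ₜ* Circle) (hμ : IsConjugateSymplectic L μ) (a : (↥(maximalRealSubfield L))ˣ)
  (hρ : HasThetaMajorants fun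
      (p : ↥(UnitaryGroup.adelic (↥(maximalRealSubfield L)) L (IsCMField.complexConj L) N (Matrix.diagonal dV)) ×
        ↥(UnitaryGroup.adelic (↥(maximalRealSubfield L)) L (IsCMField.complexConj L) 1 (JW (↥(maximalRealSubfield L)) L a)))
      (Φ : piSchwartzBruhat (↥(maximalRealSubfield L)) (Fin n')) =>
        pairRep (↥(maximalRealSubfield L)) L (IsCMField.complexConj L) N 1 e₁ (Matrix.diagonal dV) (JW (↥(maximalRealSubfield L)) L a)
          (chiSplittingLine L e₁ dV hdV hdV0 (toHeckeCharacter L μ) (isUnitary_toHeckeCharacter L μ)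
            ((isOscillatorChar_toHeckeCharacter_iff μ).mpr hμ) (TW (↥(maximalRealSubfield L)) a)
            (isUnit_det_TW (↥(maximalRealSubfield L)) a) (JW (↥(maximalRealSubfield L)) L a) (JW_eq (↥(maximalRealSubfield L)) L a))
          p Φ)
  [CompactSpace (↥(UnitaryGroup.adelic (↥(maximalRealSubfield L)) L (IsCMField.complexConj L) N (Matrix.diagonal dV)) ⧸
    (UnitaryGroup.toAdelic (↥(maximalRealSubfield L)) L (IsCMField.complexConj L) N (Matrix.diagonal dV)).range)]
  [MeasurableSpace (↥(UnitaryGroup.adelic (↥(maximalRealSubfield L)) L (IsCMField.complexConj L) 1 (JW (↥(maximalRealSubfield L)) L a)) ⧸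
    (UnitaryGroup.toAdelic (↥(maximalRealSubfield L)) L (IsCMField.complexConj L) 1 (JW (↥(maximalRealSubfield L)) L a)).range)]
  (μW : Measure (↥(UnitaryGroup.adelic (↥(maximalRealSubfield L)) L (IsCMField.complexConj L) 1 (JW (↥(maximalRealSubfield L)) L a)) ⧸
    (UnitaryGroup.toAdelic (↥(maximalRealSubfield L)) L (IsCMField.complexConj L) 1 (JW (↥(maximalRealSubfield L)) L a)).range))
  (f : C((↥(UnitaryGroup.adelic (↥(maximalRealSubfield L)) L (IsCMField.complexConj L) 1 (JW (↥(maximalRealSubfield L)) L a)) ⧸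
    (UnitaryGroup.toAdelic (↥(maximalRealSubfield L)) L (IsCMField.complexConj L) 1 (JW (↥(maximalRealSubfield L)) L a)).range), ℂ))
  [BorelSpace (↥(UnitaryGroup.adelic (↥(maximalRealSubfield L)) L (IsCMField.complexConj L) 1 (JW (↥(maximalRealSubfield L)) L a)) ⧸
    (UnitaryGroup.toAdelic (↥(maximalRealSubfield L)) L (IsCMField.complexConj L) 1 (JW (↥(maximalRealSubfield L)) L a)).range)]
  [IsFiniteMeasure μW]
  {μA : Measure (adelicGroupData (↥(maximalRealSubfield L)) L (IsCMField.complexConj L) N H).automorphicQuotient}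
  [(adelicGroupData (↥(maximalRealSubfield L)) L (IsCMField.complexConj L) N H).IsAutomorphicMeasure μA]
  [CompactSpace (adelicGroupData (↥(maximalRealSubfield L)) L (IsCMField.complexConj L) N H).automorphicQuotient]
  (P : DiscreteAutomorphicRep (adelicGroupData (↥(maximalRealSubfield L)) L (IsCMField.complexConj L) N H) μA)

include hιA

/-! ## §1 Equivariance of the projected classes under all of `U(H)(𝔸_{L⁺})` -/

/-- **THE PROJECTED THETA CLASSES ARE `U(H)(𝔸_{L⁺})`-EQUIVARIANT** (abstract transport): `pr_P [Θ̃_{ω(ιA k, 1)Ψ}(f) ∘ ιA] = R(k) (pr_P [Θ̃_Ψ(f) ∘ ιA])`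
(★ K1 `rightRegular_toLp_lineThetaLift` + ★ `DiscreteAutomorphicRep.starProjection_rightRegular`). [cite: BorelJacquet1979, §4.6]
[cite: Liu2021, proof of Prop. 4.13 Case 1 (l. 2137–2141, p. 48)] -/
theorem starProjection_toLp_lineThetaLift_pairRep (Ψ : piSchwartzBruhat (↥(maximalRealSubfield L)) (Fin n'))
    (k : (adelicGroupData (↥(maximalRealSubfield L)) L (IsCMField.complexConj L) N H).Adelic) :
    P.space.toSubmodule.starProjection
        (MemLp.toLp _ (memLp_toQuotFun_lineThetaLift L N H e₁ dV hdV hdV0 ιA hιA μ hμ a hρ μW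
          ((pairRep (↥(maximalRealSubfield L)) L (IsCMField.complexConj L) N 1 e₁ (Matrix.diagonal dV) (JW (↥(maximalRealSubfield L)) L a)
            (chiSplittingLine L e₁ dV hdV hdV0 (toHeckeCharacter L μ) (isUnitary_toHeckeCharacter L μ)
              ((isOscillatorChar_toHeckeCharacter_iff μ).mpr hμ) (TW (↥(maximalRealSubfield L)) a)
              (isUnit_det_TW (↥(maximalRealSubfield L)) a) (JW (↥(maximalRealSubfield L)) L a) (JW_eq (↥(maximalRealSubfield L)) L a)))
            (ιA k, 1) Ψ) f μA 2)) =
      (adelicGroupData (↥(maximalRealSubfield L)) L (IsCMField.complexConj L) N H).rightRegular μA k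
        (P.space.toSubmodule.starProjection
          (MemLp.toLp _ (memLp_toQuotFun_lineThetaLift L N H e₁ dV hdV hdV0 ιA hιA μ hμ a hρ μW Ψ f μA 2))) := by
  rw [← rightRegular_toLp_lineThetaLift L N H e₁ dV hdV hdV0 ιA hιA μ hμ a hρ μW Ψ f μA k,
    DiscreteAutomorphicRep.starProjection_rightRegular]

/-! ## §2 Cyclicity: one non-zero projected theta class makes every non-zero vector of `P` see a pure tensor -/

/-- **THE CLOSED SPAN OF THE PROJECTED THETA CLASSES IS ALL OF `P`** once one of them is non-zero (abstract transport): it is a closed,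
`U(H)(𝔸)`-stable (§1), non-zero subspace of the irreducible `P`. [cite: BorelJacquet1979, §4.6] [cite: DeitmarEchterhoff2014, Thm. 7.3.2] -/
theorem le_topologicalClosure_span_starProjection_toLp_lineThetaLift (Ψ₀ : piSchwartzBruhat (↥(maximalRealSubfield L)) (Fin n'))
    (hΨ₀ : P.space.toSubmodule.starProjection
      (MemLp.toLp _ (memLp_toQuotFun_lineThetaLift L N H e₁ dV hdV hdV0 ιA hιA μ hμ a hρ μW Ψ₀ f μA 2)) ≠ 0) :
    P.space.toSubmodule ≤
      (Submodule.span ℂ (Set.range fun Ψ : piSchwartzBruhat (↥(maximalRealSubfield L)) (Fin n') =>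
        P.space.toSubmodule.starProjection
          (MemLp.toLp _ (memLp_toQuotFun_lineThetaLift L N H e₁ dV hdV hdV0 ιA hιA μ hμ a hρ μW Ψ f μA 2)))).topologicalClosure := by
  set S : Submodule ℂ ((adelicGroupData (↥(maximalRealSubfield L)) L (IsCMField.complexConj L) N H).L2 μA) :=
    Submodule.span ℂ (Set.range fun Ψ : piSchwartzBruhat (↥(maximalRealSubfield L)) (Fin n') =>
      P.space.toSubmodule.starProjection
        (MemLp.toLp _ (memLp_toQuotFun_lineThetaLift L N H e₁ dV hdV hdV0 ιA hιA μ hμ a hρ μW Ψ f μA 2))) with hS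
  -- `S` is `R(k)`-stable for every `k` (§1)
  have hstab : ∀ k : (adelicGroupData (↥(maximalRealSubfield L)) L (IsCMField.complexConj L) N H).Adelic,
      S ≤ S.comap (((adelicGroupData (↥(maximalRealSubfield L)) L (IsCMField.complexConj L) N H).rightRegular μA k :
        (adelicGroupData (↥(maximalRealSubfield L)) L (IsCMField.complexConj L) N H).L2 μA →L[ℂ]
          (adelicGroupData (↥(maximalRealSubfield L)) L (IsCMField.complexConj L) N H).L2 μA) : _ →ₗ[ℂ] _) := by
    intro k
    rw [hS, Submodule.span_le]
    rintro _ ⟨Ψ, rfl⟩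
    rw [SetLike.mem_coe, Submodule.mem_comap]
    exact Submodule.subset_span ⟨_, starProjection_toLp_lineThetaLift_pairRep L N H e₁ dV hdV hdV0 ιA hιA μ hμ a hρ μW f P Ψ k⟩
  -- its closure, pulled back to the subtype `P`, is a closed subrepresentation of `P`
  have hmaps : ∀ k : (adelicGroupData (↥(maximalRealSubfield L)) L (IsCMField.complexConj L) N H).Adelic,
      Set.MapsTo ((adelicGroupData (↥(maximalRealSubfield L)) L (IsCMField.complexConj L) N H).rightRegular μA k)
        (S.topologicalClosure : Set _) (S.topologicalClosure : Set _) := by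
    intro k
    have h1 : Set.MapsTo ((adelicGroupData (↥(maximalRealSubfield L)) L (IsCMField.complexConj L) N H).rightRegular μA k)
        (S : Set _) (S : Set _) := fun x hx => hstab k hx
    have h2 := h1.closure ((adelicGroupData (↥(maximalRealSubfield L)) L (IsCMField.complexConj L) N H).rightRegular μA k).continuous
    rwa [← Submodule.topologicalClosure_coe] at h2
  let F : ContRepresentation.ClosedSubrep P.space.toContRep :=
    { toSubmodule := S.topologicalClosure.comap P.space.toSubmodule.subtype
      apply_mem_toSubmodule := fun k v hv => by
        rw [Submodule.mem_comap] at hv ⊢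
        exact hmaps k hv
      isClosed' := (Submodule.isClosed_topologicalClosure S).preimage continuous_subtype_val }
  have hF : F = ⊥ ∨ F = ⊤ := ((ContRepresentation.isTopIrreducible_iff _).1 P.irreducible).2 F
  rcases hF with hF | hF
  · -- impossible: `F` contains the non-zero class `pr_P [Θ̃_{Ψ₀}]`
    exfalso
    apply hΨ₀
    have hmem : (⟨_, P.space.toSubmodule.starProjection_apply_mem
        (MemLp.toLp _ (memLp_toQuotFun_lineThetaLift L N H e₁ dV hdV hdV0 ιA hιA μ hμ a hρ μW Ψ₀ f μA 2))⟩ : P.space.toSubmodule) ∈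
        F.toSubmodule := by
      show _ ∈ S.topologicalClosure.comap P.space.toSubmodule.subtype
      rw [Submodule.mem_comap]
      exact S.le_topologicalClosure (Submodule.subset_span ⟨Ψ₀, rfl⟩)
    rw [hF] at hmem
    have h0 := (ContRepresentation.ClosedSubrep.mem_bot (π := P.space.toContRep)).1 hmem
    exact congrArg Subtype.val h0
  · intro v hv
    have hmem : (⟨v, hv⟩ : P.space.toSubmodule) ∈ F.toSubmodule := by
      rw [hF]; exact ContRepresentation.ClosedSubrep.mem_top (π := P.space.toContRep) _
    exact (Submodule.mem_comap.1 hmem)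

/-- **EVERY NON-ZERO `v ∈ P` PAIRS NON-TRIVIALLY WITH SOME PROJECTED THETA CLASS** once one of them is non-zero (abstract transport) —
otherwise `v` is orthogonal to their closed span, which contains `v`. [cite: BorelJacquet1979, §4.6] [cite: DeitmarEchterhoff2014, Thm. 7.3.2] -/
theorem exists_inner_starProjection_toLp_lineThetaLift_ne_zero (Ψ₀ : piSchwartzBruhat (↥(maximalRealSubfield L)) (Fin n'))
    (hΨ₀ : P.space.toSubmodule.starProjection
      (MemLp.toLp _ (memLp_toQuotFun_lineThetaLift L N H e₁ dV hdV hdV0 ιA hιA μ hμ a hρ μW Ψ₀ f μA 2)) ≠ 0)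
    {v : (adelicGroupData (↥(maximalRealSubfield L)) L (IsCMField.complexConj L) N H).L2 μA} (hv : v ∈ P.space.toSubmodule) (hv0 : v ≠ 0) :
    ∃ Ψ : piSchwartzBruhat (↥(maximalRealSubfield L)) (Fin n'),
      ⟪v, P.space.toSubmodule.starProjection
        (MemLp.toLp _ (memLp_toQuotFun_lineThetaLift L N H e₁ dV hdV hdV0 ιA hιA μ hμ a hρ μW Ψ f μA 2))⟫_ℂ ≠ 0 := by
  by_contra hcon
  push Not at hcon
  -- `S ≤ (ℂ ∙ v)ᗮ`, hence its closure too
  have hle : (Submodule.span ℂ (Set.range fun Ψ : piSchwartzBruhat (↥(maximalRealSubfield L)) (Fin n') =>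
      P.space.toSubmodule.starProjection
        (MemLp.toLp _ (memLp_toQuotFun_lineThetaLift L N H e₁ dV hdV hdV0 ιA hιA μ hμ a hρ μW Ψ f μA 2)))).topologicalClosure ≤
      (ℂ ∙ v)ᗮ := by
    refine Submodule.topologicalClosure_minimal _ ?_ (Submodule.isClosed_orthogonal _)
    rw [Submodule.span_le]
    rintro _ ⟨Ψ, rfl⟩
    rw [SetLike.mem_coe, Submodule.mem_orthogonal_singleton_iff_inner_right]
    exact hcon Ψ
  have hvmem := hle (le_topologicalClosure_span_starProjection_toLp_lineThetaLift L N H e₁ dV hdV hdV0 ιA hιA μ hμ a hρ μW f P Ψ₀ hΨ₀ hv)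
  rw [Submodule.mem_orthogonal_singleton_iff_inner_right] at hvmem
  exact hv0 (inner_self_eq_zero.1 hvmem)

/-- **CYCLICITY OF THE PROJECTED THETA CLASSES** (abstract transport): if `pr_P [Θ̃_{Ψ₀}(f) ∘ ιA] ≠ 0` for ONE Schwartz–Bruhat `Ψ₀`, then for
every non-zero `v ∈ P` there is a PURE TENSOR `E(φ ⊗ Φ_f)` with `⟪v, pr_P [Θ̃_{E(φ ⊗ Φ_f)}(f) ∘ ιA]⟫ ≠ 0` (the previous lemma, and the value of the
LINEAR functional `x ↦ ⟪v, pr_P x⟫` on some class is its value on the class of a pure tensor, ★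
`F0LD2ThetaTensorClasses.exists_tensor_of_apply_toLp_lineThetaLift_ne_zero`; ★ `coe_piSchwartzBruhatEquiv_tmul` reads the factorizable function as
`E(φ ⊗ Φ_f)`). [cite: BorelJacquet1979, §4.6] [cite: Tate1967, §3.2] [cite: Liu2021, proof of Prop. 4.13 Case 1 (l. 2137–2141, p. 48)] -/
theorem exists_tmul_inner_starProjection_toLp_lineThetaLift_ne_zero (Ψ₀ : piSchwartzBruhat (↥(maximalRealSubfield L)) (Fin n'))
    (hΨ₀ : P.space.toSubmodule.starProjection
      (MemLp.toLp _ (memLp_toQuotFun_lineThetaLift L N H e₁ dV hdV hdV0 ιA hιA μ hμ a hρ μW Ψ₀ f μA 2)) ≠ 0)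
    {v : (adelicGroupData (↥(maximalRealSubfield L)) L (IsCMField.complexConj L) N H).L2 μA} (hv : v ∈ P.space.toSubmodule) (hv0 : v ≠ 0) :
    ∃ (φ : 𝓢((Fin n' → mixedEmbedding.mixedSpace ↥(maximalRealSubfield L)), ℂ)) (Φf : FinSB (↥(maximalRealSubfield L)) (Fin n')),
      ⟪v, P.space.toSubmodule.starProjection
        (MemLp.toLp _ (memLp_toQuotFun_lineThetaLift L N H e₁ dV hdV hdV0 ιA hιA μ hμ a hρ μW
          (piSchwartzBruhatEquiv (↥(maximalRealSubfield L)) (Fin n') (φ ⊗ₜ[ℂ] Φf)) f μA 2))⟫_ℂ ≠ 0 := by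
  obtain ⟨Ψ, hΨ⟩ := exists_inner_starProjection_toLp_lineThetaLift_ne_zero L N H e₁ dV hdV hdV0 ιA hιA μ hμ a hρ μW f P Ψ₀ hΨ₀ hv hv0
  -- the linear functional `x ↦ ⟪v, pr_P x⟫`
  set Sv : (adelicGroupData (↥(maximalRealSubfield L)) L (IsCMField.complexConj L) N H).L2 μA →ₗ[ℂ] ℂ :=
    (innerSL ℂ v).toLinearMap.comp P.space.toSubmodule.starProjection.toLinearMap with hSv
  have hSv' : ∀ x, Sv x = ⟪v, P.space.toSubmodule.starProjection x⟫_ℂ := fun x => rfl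
  obtain ⟨Φinf, Φfin, hfin, hne⟩ := exists_tensor_of_apply_toLp_lineThetaLift_ne_zero L N H e₁ dV hdV hdV0 ιA hιA μ hμ a hρ μW f μA Sv Ψ
    (by rw [hSv']; exact hΨ)
  refine ⟨Φinf, ⟨Φfin, hfin⟩, ?_⟩
  have hE : piSchwartzBruhatEquiv (↥(maximalRealSubfield L)) (Fin n') (Φinf ⊗ₜ[ℂ] (⟨Φfin, hfin⟩ : FinSB (↥(maximalRealSubfield L)) (Fin n'))) =
      ⟨fun x => Φinf (piArch (↥(maximalRealSubfield L)) (Fin n') x) * Φfin (piFinite (↥(maximalRealSubfield L)) (Fin n') x),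
        tensor_mem_piSchwartzBruhat Φinf hfin⟩ :=
    Subtype.ext (coe_piSchwartzBruhatEquiv_tmul (↥(maximalRealSubfield L)) (Fin n') Φinf ⟨Φfin, hfin⟩)
  rw [← hSv', toLp_lineThetaLift_congr L N H e₁ dV hdV hdV0 ιA hιA μ hμ a hρ μW f μA hE]
  exact hne

omit [CompactSpace (adelicGroupData (↥(maximalRealSubfield L)) L (IsCMField.complexConj L) N H).automorphicQuotient] in
/-- **THE SEAM CURRENCY**: if the class `[Θ̃_{Ψ₀}(f) ∘ ιA]` itself LIES IN `P` and is non-zero (★ `MeetsThetaLiftFromLine`), then every non-zero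
`v ∈ P` pairs non-trivially with the projected class of some pure tensor (its projection is itself, Mathlib `Submodule.starProjection_eq_self_iff`).
[cite: BorelJacquet1979, §4.6] [cite: Tate1967, §3.2] -/
theorem exists_tmul_inner_starProjection_toLp_lineThetaLift_ne_zero_of_mem
    [CompactSpace (adelicGroupData (↥(maximalRealSubfield L)) L (IsCMField.complexConj L) N H).automorphicQuotient]
    (Ψ₀ : piSchwartzBruhat (↥(maximalRealSubfield L)) (Fin n'))
    (hmem : MemLp.toLp _ (memLp_toQuotFun_lineThetaLift L N H e₁ dV hdV hdV0 ιA hιA μ hμ a hρ μW Ψ₀ f μA 2) ∈ P.space.toSubmodule)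
    (hne : MemLp.toLp _ (memLp_toQuotFun_lineThetaLift L N H e₁ dV hdV hdV0 ιA hιA μ hμ a hρ μW Ψ₀ f μA 2) ≠ 0)
    {v : (adelicGroupData (↥(maximalRealSubfield L)) L (IsCMField.complexConj L) N H).L2 μA} (hv : v ∈ P.space.toSubmodule) (hv0 : v ≠ 0) :
    ∃ (φ : 𝓢((Fin n' → mixedEmbedding.mixedSpace ↥(maximalRealSubfield L)), ℂ)) (Φf : FinSB (↥(maximalRealSubfield L)) (Fin n')),
      ⟪v, P.space.toSubmodule.starProjection
        (MemLp.toLp _ (memLp_toQuotFun_lineThetaLift L N H e₁ dV hdV hdV0 ιA hιA μ hμ a hρ μW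
          (piSchwartzBruhatEquiv (↥(maximalRealSubfield L)) (Fin n') (φ ⊗ₜ[ℂ] Φf)) f μA 2))⟫_ℂ ≠ 0 :=
  exists_tmul_inner_starProjection_toLp_lineThetaLift_ne_zero L N H e₁ dV hdV hdV0 ιA hιA μ hμ a hρ μW f P Ψ₀
    (by rwa [Submodule.starProjection_eq_self_iff.2 hmem]) hv hv0

end Summit.HodgeConjecture.HodgeConjecture.Cruxes.HLiu418.F0LD2ThetaCyclicity

end
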